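import Summits.Ventures.LatticeQCDFlow.Scaling.TaggedStartContentDeficitSharp
import Summits.Ventures.LatticeQCDFlow.Scaling.TaggedCertificateLedger

/-!
HONEST FRAMING: exact (Metropolis-corrected) sampling algorithms for lattice gauge theory; figures
of merit are autocorrelation/cost numbers at stated couplings and volumes; no continuum-physics
claim.

# TaggedCostSideDeep — THE COST-SIDE INEQUALITY OF ROUTE (β) IN THE DEEP CONFIGURATION, `K ≥ 3`: FOR W26'S TAGGED CHAINS OF A DEPTH-ADJACENT PAIR FROM AN ORDINARY HUB `z` WITH
# `W_z ≤ W_b ≤ W_a`, `W_z < W_a` AND THREE PARTICLES AT OR ABOVE `z`, THE DISCOUNTED START-CONTENT DEFICIT IS PAID TWICE OVER BY `X`'S ★-CERTIFICATE SLACK: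
# `L·Σ_{n<J}(1−σ)σⁿ(y_{n+1}(z) − x_{n+1}(z))⁺ ≤ 2·s1`, `s1 = (K+M_X)x̃(★) − cost(x̃)`, `L = 2K + M_X + M_Y` (lean-2 GEN-41, ours)

Venture-side (OURS).  Cell `lqcd-flow` (pub-lqcd), unit `pub-lqcd-lean-2-g41`, 2026-08-30.  Chapter AA (route (β), the cost side), file 7 — the first typed instance of the one inequality
OPEN-MATH (b′) was reduced to (MEMO-gen40 §4: `L·D ≤ L·gap_a + 2s1 + s2 + s3`; here the stronger `L·D ≤ 2s1`).  Ingredients: file 6 (A) (`D_J ≤ (1−σ)γσq/(1−σ²q²)`,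
`γ = P_X(z,z) − P_Y(z,z) = (acc(z,b) − acc(z,a))/K ≤ (1−α)/K`, `q ≤ α/K`, `α = acc(z,a)`), file 4 (`s1 = (1−σ)slack_X(z) + σE_x̃[slack_X] + (1−σ)(1−θ_a)x̃(★)`, exact; `E_x̃[slack_X] ≥ 0`
without a presence proviso), the slack
at the hub `slack_X(z) ≥ α(K − 2 + 3θ_a)/K` when `q > 0` (W4's key inequality `acc(z,w)(1−θ_w) ≤ pW_zθ_w`, `pW_z ≤ acc(z,a)`, `P_X(z,z) < N_C(z)/K`), and the scalar fact
`(4K+2)(1−α)α/(K²−α²) ≤ α(2K−1)/K` for `K ≥ 3` (`costSide_scalar`; at `K = 3`, `α → 0` the margin is `1/27` — the second step's income, not used here, is what the toy's 19 % consist of).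

* `costSide_gamma_eq` (`γ = (acc(z,b)−acc(z,a))/K`), `costSide_gamma_le`, `costSide_q_le` (`N_C(z)/K − P_X(z,z) ≤ acc(z,a)/K`), `costSide_slack_ge` (the hub slack), `costSide_scalar`,
  **`tagged_costSide_deep`**.

Hypotheses as in file 6 (A) plus W14's (`pW ≤ 1`, `θ = 1/(1+pW)`) and `K ≥ 3`; NO presence proviso (the slack is used only where `x̃` has mass: W15 `tagged_tail_absent`); `K = 2`,
exact ties, the residual pair and the configuration `W_a < W_z` are not covered (memo MEMO-gen41 §4).  Literature grade (cell rule): OWN; nothing cited; no new bib keys.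
-/

open Finset

namespace Summit.Ventures.LatticeQCDFlow.Scaling

/-! ### §1 The scalar inequality -/
section CostScalar

/-- **`L·γ·σq/(1−(σq)²) ≤ 2α(K−2+3θ_a)/K`** for `K ≥ 3`, `L ≤ 4K+2`, `0 ≤ γ ≤ (1−α)/K`, `0 ≤ q ≤ α/K`, `σ ∈ [0,1]`, `α ∈ [0,1]`, `θ_a ∈ [½,1]`. [ours] -/
theorem costSide_scalar {K L α θa q γ σ : ℝ} (hK : 3 ≤ K) (hL : L ≤ 4 * K + 2) (hα0 : 0 ≤ α) (hα1 : α ≤ 1)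
    (hθ : 1 / 2 ≤ θa) (hγ0 : 0 ≤ γ) (hγ : γ ≤ (1 - α) / K) (hq0 : 0 ≤ q) (hq : q ≤ α / K) (hσ0 : 0 ≤ σ) (hσ1 : σ ≤ 1) :
    L * (γ * (σ * q / (1 - (σ * q) ^ 2))) ≤ 2 * (α * (K - 2 + 3 * θa) / K) := by
  have hK0 : 0 < K := by linarith
  have hqK : q ≤ 1 / 3 := by
    calc q ≤ α / K := hq
      _ ≤ 1 / K := div_le_div_of_nonneg_right hα1 hK0.le
      _ ≤ 1 / 3 := one_div_le_one_div_of_le (by norm_num) hK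
  have hσq0 : 0 ≤ σ * q := mul_nonneg hσ0 hq0
  have hσq : σ * q ≤ q := by nlinarith
  have hσq3 : σ * q ≤ 1 / 3 := hσq.trans hqK
  -- `σq/(1−(σq)²) ≤ q/(1−q²) ≤ (α/K)/(1−(α/K)²)`
  have hden1 : 0 < 1 - (σ * q) ^ 2 := by nlinarith
  have hden2 : 0 < 1 - q ^ 2 := by nlinarith
  have hαK : α / K ≤ 1 / 3 := (div_le_div_of_nonneg_right hα1 hK0.le).trans (one_div_le_one_div_of_le (by norm_num) hK)
  have hαK0 : 0 ≤ α / K := div_nonneg hα0 hK0.le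
  have hden3 : 0 < 1 - (α / K) ^ 2 := by nlinarith
  have step1 : σ * q / (1 - (σ * q) ^ 2) ≤ q / (1 - q ^ 2) := by
    rw [div_le_div_iff₀ hden1 hden2]; nlinarith [mul_nonneg hσq0 hq0]
  have step2 : q / (1 - q ^ 2) ≤ (α / K) / (1 - (α / K) ^ 2) := by
    rw [div_le_div_iff₀ hden2 hden3]; nlinarith [mul_nonneg hq0 hαK0]
  have hfrac : σ * q / (1 - (σ * q) ^ 2) ≤ (α / K) / (1 - (α / K) ^ 2) := step1.trans step2
  have hfrac0 : 0 ≤ σ * q / (1 - (σ * q) ^ 2) := div_nonneg hσq0 hden1.le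
  -- the left side is at most `(4K+2)·((1−α)/K)·((α/K)/(1−(α/K)²))`
  have h1 : L * (γ * (σ * q / (1 - (σ * q) ^ 2))) ≤ (4 * K + 2) * (((1 - α) / K) * ((α / K) / (1 - (α / K) ^ 2))) := by
    have hx : γ * (σ * q / (1 - (σ * q) ^ 2)) ≤ ((1 - α) / K) * ((α / K) / (1 - (α / K) ^ 2)) :=
      mul_le_mul hγ hfrac hfrac0 (div_nonneg (by linarith) hK0.le)
    exact mul_le_mul hL hx (mul_nonneg hγ0 hfrac0) (by linarith)
  refine h1.trans ?_
  -- clear denominators: `(4K+2)(1−α)α·K ≤ 2(K−2+3θ_a)·(K² − α²)`, using `θ_a ≥ ½` and `K ≥ 3`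
  have hKα : 0 < K ^ 2 - α ^ 2 := by nlinarith
  have e1 : (4 * K + 2) * (((1 - α) / K) * ((α / K) / (1 - (α / K) ^ 2))) = (4 * K + 2) * (1 - α) * α / (K ^ 2 - α ^ 2) := by
    field_simp
  rw [e1, show 2 * (α * (K - 2 + 3 * θa) / K) = 2 * α * (K - 2 + 3 * θa) / K by ring, div_le_div_iff₀ hKα hK0]
  -- polynomial inequality
  have hpoly : 0 ≤ 2 * K ^ 2 - 5 * K - 2 := by nlinarith
  nlinarith [mul_nonneg hα0 (by nlinarith : (0:ℝ) ≤ 4 * K ^ 2 + 1), mul_nonneg (mul_nonneg hα0 hα0) (by linarith : (0:ℝ) ≤ 2 * K - 1),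
    mul_nonneg hα0 hpoly, mul_nonneg (sub_nonneg.mpr hα1) hα0, mul_nonneg (by linarith : (0:ℝ) ≤ θa - 1 / 2) (mul_nonneg hα0 hKα.le)]

end CostScalar

/-! ### §2 The kernel data at the hub and the hub slack -/
section CostHub
variable {S : Type*} [Fintype S] [DecidableEq S]
variable {W θ : S → ℝ} {acc : S → S → ℝ} {p : ℝ} {K : ℕ} {NC : S → ℕ} {a b : S} {PX PY : Option S → Option S → ℝ}

omit [Fintype S] in
/-- `γ = P_X(z,z) − P_Y(z,z) = (acc(z,b) − acc(z,a))/K`. [ours] -/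
theorem costSide_gamma_eq [Fintype S]
    (hPXoff : ∀ h v, h ≠ v → PX (some h) (some v) = if NC h = 0 then 0 else (NC v : ℝ) / K * acc h v)
    (hPXin : ∀ h, PX (some h) none = if NC h = 0 then 0 else acc h a / K)
    (hPXdiag : ∀ h, PX (some h) (some h) = 1 - (∑ v ∈ univ.erase h, PX (some h) (some v) + PX (some h) none))
    (hPYoff : ∀ h v, h ≠ v → PY (some h) (some v) = if NC h = 0 then 0 else (NC v : ℝ) / K * acc h v)
    (hPYin : ∀ h, PY (some h) none = if NC h = 0 then 0 else acc h b / K)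
    (hPYdiag : ∀ h, PY (some h) (some h) = 1 - (∑ v ∈ univ.erase h, PY (some h) (some v) + PY (some h) none))
    {z : S} (hz : NC z ≠ 0) : PX (some z) (some z) - PY (some z) (some z) = (acc z b - acc z a) / K := by
  have hS : ∑ v ∈ univ.erase z, PX (some z) (some v) = ∑ v ∈ univ.erase z, PY (some z) (some v) :=
    sum_congr rfl fun v hv => by rw [hPXoff z v (ne_of_mem_erase hv).symm, hPYoff z v (ne_of_mem_erase hv).symm]
  rw [hPXdiag, hPYdiag, hS, hPXin, hPYin, if_neg hz, if_neg hz]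
  ring

omit [Fintype S] [DecidableEq S] in
/-- `0 ≤ γ ≤ (1 − acc(z,a))/K` (`W_b ≤ W_a`). [ours] -/
theorem costSide_gamma_le (hW : ∀ v, 0 < W v) (hacc : ∀ h v, acc h v = min 1 (W h / W v)) (hab : W b ≤ W a) (hK : 1 ≤ K) (z : S) :
    0 ≤ (acc z b - acc z a) / K ∧ (acc z b - acc z a) / K ≤ (1 - acc z a) / K := by
  have hK0 : (0 : ℝ) < K := by exact_mod_cast hK
  have h1 : acc z a ≤ acc z b := by
    rw [hacc, hacc]; exact min_le_min le_rfl (div_le_div_of_nonneg_left (hW z).le (hW b) hab)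
  have h2 : acc z b ≤ 1 := by rw [hacc]; exact min_le_left _ _
  exact ⟨div_nonneg (by linarith) hK0.le, div_le_div_of_nonneg_right (by linarith) hK0.le⟩

/-- **`N_C(z)/K − P_X(z,z) ≤ acc(z,a)/K`** (`Σ N_C = K`, `acc ≤ 1`). [ours] -/
theorem costSide_q_le (hacc : ∀ h v, acc h v = min 1 (W h / W v)) (hK : 1 ≤ K) (hNC : ∑ v, NC v = K)
    (hPXoff : ∀ h v, h ≠ v → PX (some h) (some v) = if NC h = 0 then 0 else (NC v : ℝ) / K * acc h v)
    (hPXin : ∀ h, PX (some h) none = if NC h = 0 then 0 else acc h a / K)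
    (hPXdiag : ∀ h, PX (some h) (some h) = 1 - (∑ v ∈ univ.erase h, PX (some h) (some v) + PX (some h) none))
    {z : S} (hz : NC z ≠ 0) : (NC z : ℝ) / K - PX (some z) (some z) ≤ acc z a / K := by
  have hK0 : (0 : ℝ) < K := by exact_mod_cast hK
  have hoff : ∑ v ∈ univ.erase z, PX (some z) (some v) ≤ ∑ v ∈ univ.erase z, (NC v : ℝ) / K := by
    refine sum_le_sum fun v hv => ?_
    rw [hPXoff z v (ne_of_mem_erase hv).symm, if_neg hz]
    have h1 : acc z v ≤ 1 := by rw [hacc]; exact min_le_left _ _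
    have h0 : 0 ≤ (NC v : ℝ) / K := div_nonneg (Nat.cast_nonneg _) hK0.le
    nlinarith
  have hsum : ∑ v ∈ univ.erase z, (NC v : ℝ) / K = 1 - (NC z : ℝ) / K := by
    have h := add_sum_erase univ (fun v => (NC v : ℝ) / K) (mem_univ z)
    have htot : ∑ v, (NC v : ℝ) / K = 1 := by
      rw [← sum_div, show ∑ v, (NC v : ℝ) = K by exact_mod_cast hNC, div_self hK0.ne']
    rw [htot] at h
    linarith
  rw [hPXdiag, hPXin, if_neg hz]
  have := hoff.trans (le_of_eq hsum)
  linarith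

/-- **The hub slack when the holding probability is below `N_C(z)/K`:** `slack_X(z) ≥ acc(z,a)(K − 2 + 3θ_a)/K`. [ours] -/
theorem costSide_slack_ge (hW : ∀ v, 0 < W v) (hp0 : 0 ≤ p) (hp : ∀ v, p * W v ≤ 1) (hθ : ∀ v, θ v = 1 / (1 + p * W v))
    (hacc : ∀ h v, acc h v = min 1 (W h / W v))
    (hPXoff : ∀ h v, h ≠ v → PX (some h) (some v) = if NC h = 0 then 0 else (NC v : ℝ) / K * acc h v)
    (hPXin : ∀ h, PX (some h) none = if NC h = 0 then 0 else acc h a / K)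
    (hK : 1 ≤ K) {M : ℝ} (hM : M = ∑ v, θ v * (NC v : ℝ) + θ a)
    {r Λ sl : Option S → ℝ} (hrn : r none = (K + M) - (1 - θ a)) (hrs : ∀ v, r (some v) = -(1 - θ v))
    (hΛn : Λ none = -(1 - θ a)) (hΛs : ∀ v, Λ (some v) = 0) (hsl : ∀ t, sl t = ∑ t', PX t t' * (r t' + Λ t') - Λ t)
    {z : S} (hz : NC z ≠ 0) (hhold : PX (some z) (some z) ≤ (NC z : ℝ) / K) :
    acc z a * ((K : ℝ) - 2 + 3 * θ a) / K ≤ sl (some z) := by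
  have hθm := theta_mem hW hp0 hp hθ
  have hK0 : (0 : ℝ) < K := by exact_mod_cast hK
  have hα0 : 0 ≤ acc z a := starHub_acc_nonneg hW hacc z a
  have hpz : p * W z ≤ acc z a := tagged_acc_tag_ge hW hp hacc z
  have hpz0 : 0 ≤ p * W z := mul_nonneg hp0 (hW z).le
  rw [hsl, hΛs, tagged_sum_option, hrn, hΛn, hPXin, if_neg hz]
  simp_rw [hrs, hΛs, add_zero]
  rw [← Finset.sum_erase_add univ (fun w => PX (some z) (some w) * -(1 - θ w)) (mem_univ z)]
  -- off-diagonal costs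
  have hoff : ∑ w ∈ univ.erase z, PX (some z) (some w) * (1 - θ w) ≤ p * W z / K * ∑ w ∈ univ.erase z, (NC w : ℝ) * θ w := by
    rw [mul_sum]
    refine sum_le_sum fun w hw => ?_
    rw [hPXoff z w (ne_of_mem_erase hw).symm, if_neg hz]
    have hk := starHub_theta_acc_key hW hp0 hθ hacc z w
    have hNK : 0 ≤ (NC w : ℝ) / K := div_nonneg (Nat.cast_nonneg _) hK0.le
    calc (NC w : ℝ) / K * acc z w * (1 - θ w) = (NC w : ℝ) / K * (acc z w * (1 - θ w)) := by ring
      _ ≤ (NC w : ℝ) / K * (p * W z * θ w) := mul_le_mul_of_nonneg_left hk hNK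
      _ = p * W z / K * ((NC w : ℝ) * θ w) := by ring
  -- the diagonal cost, using the small holding probability
  have hdc : PX (some z) (some z) * (1 - θ z) ≤ (NC z : ℝ) / K * (p * W z * θ z) := by
    have e : 1 - θ z = p * W z * θ z := by
      have hden : 0 < 1 + p * W z := by linarith
      rw [hθ z]; field_simp; ring
    rw [e]; exact mul_le_mul_of_nonneg_right hhold (by rw [← e]; linarith [(hθm z).2])
  -- the mass identity
  have hmass : ∑ w ∈ univ.erase z, (NC w : ℝ) * θ w + (NC z : ℝ) * θ z = M - θ a := by
    rw [hM, ← Finset.sum_erase_add univ (fun v => θ v * (NC v : ℝ)) (mem_univ z)]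
    have : ∑ w ∈ univ.erase z, (NC w : ℝ) * θ w = ∑ w ∈ univ.erase z, θ w * (NC w : ℝ) := sum_congr rfl fun w _ => by ring
    rw [this]; ring
  have hMθ : 0 ≤ M - θ a := by
    rw [← hmass]
    exact add_nonneg (sum_nonneg fun w _ => mul_nonneg (Nat.cast_nonneg _) (by linarith [(hθm w).1])) (mul_nonneg (Nat.cast_nonneg _) (by linarith [(hθm z).1]))
  have hneg : ∑ w ∈ univ.erase z, PX (some z) (some w) * -(1 - θ w) = -∑ w ∈ univ.erase z, PX (some z) (some w) * (1 - θ w) := by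
    rw [← sum_neg_distrib]; exact sum_congr rfl fun w _ => by ring
  rw [hneg]
  -- total cost `≤ (pW_z/K)(M − θ_a) ≤ (acc(z,a)/K)(M − θ_a)`
  have hcost : ∑ w ∈ univ.erase z, PX (some z) (some w) * (1 - θ w) + PX (some z) (some z) * (1 - θ z) ≤ acc z a / K * (M - θ a) := by
    have h1 : ∑ w ∈ univ.erase z, PX (some z) (some w) * (1 - θ w) + PX (some z) (some z) * (1 - θ z) ≤ p * W z / K * (M - θ a) := by
      calc ∑ w ∈ univ.erase z, PX (some z) (some w) * (1 - θ w) + PX (some z) (some z) * (1 - θ z)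
          ≤ p * W z / K * ∑ w ∈ univ.erase z, (NC w : ℝ) * θ w + (NC z : ℝ) / K * (p * W z * θ z) := add_le_add hoff hdc
        _ = p * W z / K * (∑ w ∈ univ.erase z, (NC w : ℝ) * θ w + (NC z : ℝ) * θ z) := by ring
        _ = p * W z / K * (M - θ a) := by rw [hmass]
    have h2 : p * W z / K * (M - θ a) ≤ acc z a / K * (M - θ a) :=
      mul_le_mul_of_nonneg_right (div_le_div_of_nonneg_right hpz hK0.le) hMθ
    linarith
  have e : acc z a / K * ((K : ℝ) + M - 2 * (1 - θ a)) - acc z a / K * (M - θ a) = acc z a * ((K : ℝ) - 2 + 3 * θ a) / K := by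
    field_simp; ring
  nlinarith [hcost, e]

end CostHub

/-! ### §3 The cost-side inequality -/
section CostSide
variable {S : Type*} [Fintype S] [DecidableEq S]
variable {W θ : S → ℝ} {acc : S → S → ℝ} {p : ℝ} {K : ℕ} {NC : S → ℕ} {a b : S} {PX PY : Option S → Option S → ℝ}

/-- **THE COST-SIDE INEQUALITY, DEEP CONFIGURATION, `K ≥ 3`:** `L·Σ_{n<J}(1−σ)σⁿ(y_{n+1}(z) − x_{n+1}(z))⁺ ≤ 2·s1`. [ours] -/
theorem tagged_costSide_deep (hW : ∀ v, 0 < W v) (hp0 : 0 ≤ p) (hp : ∀ v, p * W v ≤ 1) (hθ : ∀ v, θ v = 1 / (1 + p * W v))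
    (hacc : ∀ h v, acc h v = min 1 (W h / W v)) (hK : 3 ≤ K) (hNC : ∑ v, NC v = K) (hab : W b ≤ W a)
    (hnone : ∀ w, NC w ≠ 0 → ¬ (W b < W w ∧ W w < W a))
    (hPXoff : ∀ h v, h ≠ v → PX (some h) (some v) = if NC h = 0 then 0 else (NC v : ℝ) / K * acc h v)
    (hPXin : ∀ h, PX (some h) none = if NC h = 0 then 0 else acc h a / K)
    (hPXdiag : ∀ h, PX (some h) (some h) = 1 - (∑ v ∈ univ.erase h, PX (some h) (some v) + PX (some h) none))
    (hPXout : ∀ v, PX none (some v) = (NC v : ℝ) / K * acc a v) (hPXstay : PX none none = 1 - ∑ v, PX none (some v))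
    (hPYoff : ∀ h v, h ≠ v → PY (some h) (some v) = if NC h = 0 then 0 else (NC v : ℝ) / K * acc h v)
    (hPYin : ∀ h, PY (some h) none = if NC h = 0 then 0 else acc h b / K)
    (hPYdiag : ∀ h, PY (some h) (some h) = 1 - (∑ v ∈ univ.erase h, PY (some h) (some v) + PY (some h) none))
    (hPYout : ∀ v, PY none (some v) = (NC v : ℝ) / K * acc b v) (hPYstay : PY none none = 1 - ∑ v, PY none (some v))
    {z : S} (hz : NC z ≠ 0) (hzb : W z ≤ W b) (hza : W z < W a) (hthree : 2 ≤ NC z ∨ ∃ w, NC w ≠ 0 ∧ W z < W w)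
    {x y : ℕ → Option S → ℝ}
    (hx0 : ∀ v, x 0 v = if v = some z then 1 else 0) (hxs : ∀ n v, x (n + 1) v = ∑ h, x n h * PX h v)
    (hy0 : ∀ v, y 0 v = if v = some z then 1 else 0) (hys : ∀ n v, y (n + 1) v = ∑ h, y n h * PY h v)
    {M : ℝ} (hM : M = ∑ v, θ v * (NC v : ℝ) + θ a) {L : ℝ} (hL : L = 2 * K + M + (∑ v, θ v * (NC v : ℝ) + θ b))
    {σ : ℝ} (hσ0 : 0 ≤ σ) (hσ1 : σ < 1) {ut : Option S → ℝ} (hut : ∀ t, ut t = (1 - σ) * PX (some z) t + σ * ∑ t', ut t' * PX t' t) (J : ℕ) :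
    L * ∑ n ∈ range J, (1 - σ) * σ ^ n * max 0 (y (n + 1) (some z) - x (n + 1) (some z))
      ≤ 2 * ((K + M) * ut none - (∑ v, ut (some v) * (1 - θ v) + ut none * (1 - θ a))) := by
  have hK1 : 1 ≤ K := by omega
  have hK2 : 2 ≤ K := by omega
  have hK0 : (0 : ℝ) < K := by exact_mod_cast (show 0 < K by omega)
  have hK3 : (3 : ℝ) ≤ K := by exact_mod_cast hK
  have hθm := theta_mem hW hp0 hp hθ
  -- the deficit budget (file 6 (A))
  obtain ⟨hA, -, -, -⟩ := tagged_startClass_deficit hW hacc hK2 hNC hab hnone hPXoff hPXin hPXdiag hPXout hPXstay hPYoff hPYin hPYdiag hPYout hPYstay hz hx0 hxs hy0 hys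
  obtain ⟨-, hD⟩ := hA hzb hza hthree
  have hDJ := hD σ hσ0 hσ1.le J
  -- the certificate slack (file 4)
  obtain ⟨r, hr⟩ : ∃ r : Option S → ℝ, ∀ t, r t = Option.elim t ((K + M) - (1 - θ a)) (fun v => -(1 - θ v)) := ⟨_, fun _ => rfl⟩
  obtain ⟨Λ, hΛ⟩ : ∃ Λ : Option S → ℝ, ∀ t, Λ t = Option.elim t (-(1 - θ a)) (fun _ => 0) := ⟨_, fun _ => rfl⟩
  obtain ⟨sl, hsl⟩ : ∃ sl : Option S → ℝ, ∀ t, sl t = ∑ t', PX t t' * (r t' + Λ t') - Λ t := ⟨_, fun _ => rfl⟩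
  have hrn : r none = (K + M) - (1 - θ a) := by rw [hr]; rfl
  have hrs : ∀ v, r (some v) = -(1 - θ v) := fun v => by rw [hr]; rfl
  have hΛn : Λ none = -(1 - θ a) := by rw [hΛ]; rfl
  have hΛs : ∀ v, Λ (some v) = 0 := fun v => by rw [hΛ]; rfl
  -- `s1 = (1−σ)slack(z) + σE_ũ[slack] + (1−σ)(1−θ_a)ũ(★)` (file 4, exact), with `E_ũ[slack] ≥ 0`: the slack is `≥ 0` at ★ and at every PRESENT content
  -- (W14's super-solution conditions), and `ũ` gives no mass to absent contents (W15) — no presence proviso is needed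
  have heq := ledger_tail_eq hsl hut
  have hP0 := tagged_nonneg hW hacc hPXoff hPXin hPXdiag hPXout hPXstay hK1 hNC
  have hP1 := tagged_rowsum (P := PX) hPXdiag hPXstay
  have hut0 : ∀ t, 0 ≤ ut t := geomResolvent_nonneg hP0 hP1 hσ0 hσ1 (ν := fun t => PX (some z) t) (fun t => hP0 _ _) hut
  have hsl_none : 0 ≤ sl none := by
    rw [hsl]; linarith [tagged_supersolution_none hW hp0 hp hθ hacc hPXout hPXstay hK1 hNC hM hrn hrs hΛn hΛs]
  have hsl_some : ∀ v, NC v ≠ 0 → 0 ≤ sl (some v) := fun v hv => by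
    rw [hsl]; linarith [tagged_supersolution_some hW hp0 hp hθ hacc hPXoff hPXin hPXdiag hK1 hNC hM hrn hrs hΛn hΛs hv]
  have hE : 0 ≤ ∑ t, ut t * sl t := by
    rw [tagged_sum_option]
    refine add_nonneg (mul_nonneg (hut0 none) hsl_none) (sum_nonneg fun v _ => ?_)
    by_cases hv : NC v = 0
    · rw [tagged_tail_absent hW hacc hPXoff hPXin hPXdiag hPXout hPXstay hK1 hNC hσ0 hσ1 hz hut hv, zero_mul]
    · exact mul_nonneg (hut0 _) (hsl_some v hv)
  have hΛz : Λ (some z) = 0 := hΛs z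
  have hEΛ : ∑ t, ut t * Λ t = -(1 - θ a) * ut none := by rw [tagged_sum_option, hΛn]; simp [hΛs]; ring
  have hEr : ∑ t, ut t * r t = (K + M) * ut none - (∑ v, ut (some v) * (1 - θ v) + ut none * (1 - θ a)) := by
    rw [tagged_sum_option, hrn]; simp only [hrs]
    have e : ∑ v, ut (some v) * -(1 - θ v) = -∑ v, ut (some v) * (1 - θ v) := by rw [← sum_neg_distrib]; exact sum_congr rfl fun v _ => by ring
    rw [e]; ring
  have hs1' : (1 - σ) * sl (some z) ≤ (K + M) * ut none - (∑ v, ut (some v) * (1 - θ v) + ut none * (1 - θ a)) := by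
    rw [← hEr, heq, hΛz, hEΛ]
    have h1 : 0 ≤ σ * ∑ t, ut t * sl t := mul_nonneg hσ0 hE
    have h2 : 0 ≤ (1 - σ) * (0 - -(1 - θ a) * ut none) := by
      have e : (1 - σ) * (0 - -(1 - θ a) * ut none) = (1 - σ) * ((1 - θ a) * ut none) := by ring
      rw [e]
      exact mul_nonneg (by linarith only [hσ1]) (mul_nonneg (by linarith only [(hθm a).2]) (hut0 none))
    linarith only [h1, h2]
  -- the kernel data at the hub
  set γ := PX (some z) (some z) - PY (some z) (some z) with hγdef
  set q := max 0 ((NC z : ℝ) / K - PX (some z) (some z)) with hqdef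
  have hγeq : γ = (acc z b - acc z a) / K := costSide_gamma_eq hPXoff hPXin hPXdiag hPYoff hPYin hPYdiag hz
  obtain ⟨hγ0, hγle⟩ := costSide_gamma_le hW hacc hab hK1 z
  rw [← hγeq] at hγ0 hγle
  have hq0 : 0 ≤ q := le_max_left _ _
  have hqle : q ≤ acc z a / K := max_le (div_nonneg (starHub_acc_nonneg hW hacc z a) hK0.le) (costSide_q_le hacc hK1 hNC hPXoff hPXin hPXdiag hz)
  have hα0 : 0 ≤ acc z a := starHub_acc_nonneg hW hacc z a
  have hα1 : acc z a ≤ 1 := by rw [hacc]; exact min_le_left _ _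
  -- `L ≤ 4K + 2`
  have hMC : ∑ v, θ v * (NC v : ℝ) ≤ K := by
    calc ∑ v, θ v * (NC v : ℝ) ≤ ∑ v, (NC v : ℝ) := sum_le_sum fun v _ =>
            mul_le_of_le_one_left (Nat.cast_nonneg _) (hθm v).2
      _ = K := by exact_mod_cast hNC
  have hMC0 : 0 ≤ ∑ v, θ v * (NC v : ℝ) := sum_nonneg fun v _ => mul_nonneg (by linarith [(hθm v).1]) (Nat.cast_nonneg _)
  have hL0 : 0 ≤ L := by rw [hL, hM]; linarith only [hMC0, (hθm a).1, (hθm b).1, hK0]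
  have hL4 : L ≤ 4 * K + 2 := by rw [hL, hM]; linarith only [hMC, (hθm a).2, (hθm b).2]
  -- case `q = 0`: no deficit budget
  have hD0 : 0 ≤ ∑ n ∈ range J, (1 - σ) * σ ^ n * max 0 (y (n + 1) (some z) - x (n + 1) (some z)) :=
    sum_nonneg fun n _ => mul_nonneg (mul_nonneg (by linarith) (pow_nonneg hσ0 n)) (le_max_left _ _)
  have hs10 : 0 ≤ (K + M) * ut none - (∑ v, ut (some v) * (1 - θ v) + ut none * (1 - θ a)) := by
    have := mul_nonneg (by linarith only [hσ1] : (0:ℝ) ≤ 1 - σ) (hsl_some z hz); linarith only [this, hs1']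
  by_cases hq : q = 0
  · have hle0 : ∑ n ∈ range J, (1 - σ) * σ ^ n * max 0 (y (n + 1) (some z) - x (n + 1) (some z)) ≤ 0 := by
      refine hDJ.trans ?_
      rw [hq]; simp
    have hD00 : ∑ n ∈ range J, (1 - σ) * σ ^ n * max 0 (y (n + 1) (some z) - x (n + 1) (some z)) = 0 := le_antisymm hle0 hD0
    rw [hD00, mul_zero]; linarith only [hs10]
  · -- `q > 0`: the holding probability is below `N_C(z)/K`, the hub slack pays
    have hqpos : 0 < q := lt_of_le_of_ne hq0 (Ne.symm hq)
    have hhold : PX (some z) (some z) ≤ (NC z : ℝ) / K := by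
      by_contra hcon
      have h' : (NC z : ℝ) / K - PX (some z) (some z) ≤ 0 := by linarith only [not_le.mp hcon]
      exact hq (le_antisymm (max_le le_rfl h') hq0)
    have hslack := costSide_slack_ge hW hp0 hp hθ hacc hPXoff hPXin hK1 hM hrn hrs hΛn hΛs hsl hz hhold
    have hscal := costSide_scalar hK3 hL4 hα0 hα1 (hθm a).1 hγ0 hγle hq0 hqle hσ0 hσ1.le
    -- chain
    calc L * ∑ n ∈ range J, (1 - σ) * σ ^ n * max 0 (y (n + 1) (some z) - x (n + 1) (some z))
        ≤ L * ((1 - σ) * (γ * (σ * q / (1 - (σ * q) ^ 2)))) := mul_le_mul_of_nonneg_left hDJ hL0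
      _ = (1 - σ) * (L * (γ * (σ * q / (1 - (σ * q) ^ 2)))) := by ring
      _ ≤ (1 - σ) * (2 * (acc z a * ((K : ℝ) - 2 + 3 * θ a) / K)) := mul_le_mul_of_nonneg_left hscal (by linarith)
      _ ≤ (1 - σ) * (2 * sl (some z)) := mul_le_mul_of_nonneg_left (by linarith only [hslack]) (by linarith only [hσ1])
      _ = 2 * ((1 - σ) * sl (some z)) := by ring
      _ ≤ 2 * ((K + M) * ut none - (∑ v, ut (some v) * (1 - θ v) + ut none * (1 - θ a))) := mul_le_mul_of_nonneg_left hs1' (by norm_num)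

end CostSide

end Summit.Ventures.LatticeQCDFlow.Scaling
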